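import Literature.Probability.RandomPlanarGeometry.ObservableShortTime
import Literature.Probability.RandomPlanarGeometry.LoewnerCotArgExit
import Literature.Probability.RandomPlanarGeometry.SLEKappaRhoSchrammObservable
import Literature.Analysis.Complex.UnivalentNearbyPoints
import HarnessLib

/-!
# Loewner chains forget a short initial piece of the driver at far points (late agreement)

Topic `Literature/Probability/RandomPlanarGeometry` (deterministic chordal Loewner calculus in `ℍ`,
continuous driving functions; G. F. Lawler, *Conformally Invariant Processes in the Plane* (2005),
Ch. 4 §4.1 and Rem. 4.9). Two results:

* **Capacity displacement bound** `Loewner.norm_map_sub_self_le_div_im`: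
  `‖g_t(z) - z‖ ≤ 2t / Im g_t(z)` for `z ∈ ℍ`, `t < T_z` — integrate `|ġ_s| = 2/|g_s - W_s| ≤ 2/Im g_s`
  along the flow, the imaginary part being non-increasing ((4.5)); since `hcap(K_t) = 2t`
  (Thm. 4.6) this is the Loewner-chain case of `|g_A(z) - z| ≤ hcap(A)/Im g_A(z)`. In CDHKS's
  short-time regime `9t ≤ (Im z)²` (`Loewner.ShortTime`, `ObservableShortTime.lean`) it gives
  `‖g_t(z) - z‖ ≤ 3t/Im z` and `|log |g_t'(z)|| ≤ 9t/(2 (Im z)²)` (`ShortTime.norm_map_sub_self_le`,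
  `ShortTime.abs_log_norm_deriv_map_le`).
* **Late agreement** (section `LateAgree`): if two continuous driving
  functions agree from time `s` on, then by the cocycle `g_t = g^{W(s+·)}_{t-s} ∘ g_s` (Rem. 4.9,
  the tree's `Loewner.map_add`) their chains at time `t ≥ s` differ only through the inner maps
  `g_s`, `g'_s`, which are `3s/Im z`-close to the identity; reading the common univalent outer map
  at the two nearby inner points (Koebe distortion and one-quarter theorem in logarithmic form,
  `Literature/Analysis/Complex/UnivalentNearbyPoints.lean`) gives, at a point `z` with
  `16 t ≤ (Im z)²` and `1200 s ≤ (Im z)²`,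
  `|log ψ_t(z) - log ψ'_t(z)| ≤ 1500 s/(Im z)²` for Rohde–Schramm's ratios `ψ = Loewner.derivRatio`
  (`abs_log_derivRatio_sub_le_of_eqOn`), `|S_t(z) - S'_t(z)| ≤ 600 s/(Im z)²` for Schramm's
  observables (`abs_schrammObs_sub_le_of_eqOn`), and `‖g_t(z) - g'_t(z)‖ ≤ 600 s/Im z`
  (`norm_map_sub_map_le_of_eqOn`); e.g. for the driver frozen before `s`, `u ↦ W (u ∨ s)`
  (`late_agreement_max`). Constants are not optimised. NOT here: the same comparison with the
  hydrodynamic map of a general (non-Loewner) hull as one inner map.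

## References

* G. F. Lawler, *Conformally Invariant Processes in the Plane*, AMS (2005), Ch. 4 §4.1 ((4.5),
  Thm. 4.6), Rem. 4.9 [Lawler2005].
* D. Chelkak, H. Duminil-Copin, C. Hongler, A. Kemppainen, S. Smirnov, C. R. Math. 352 (2014) §3.
-/

noncomputable section

open Set Filter MeasureTheory Metric Complex
open _root_.Topology
open UpperHalfPlane (upperHalfPlaneSet isOpen_upperHalfPlaneSet)
open Literature.Analysis.Complex
open scoped NNReal

namespace Literature.Probability.RandomPlanarGeometry

namespace Loewner

variable {W : ℝ≥0 → ℝ} {z : ℂ}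

/-! ### The capacity displacement bound along the Loewner flow -/

/-- The Loewner field at a point of `ℍ` is bounded by `2 / Im`: `‖2/(w - W_s)‖ ≤ 2 / Im w`
(`|w - x| ≥ Im w` for real `x`). [folklore] -/
theorem norm_vectorField_le_two_div_im (W : ℝ≥0 → ℝ) (s : ℝ) {w : ℂ} (hw : 0 < w.im) :
    ‖vectorField W s w‖ ≤ 2 / w.im := by
  rw [vectorField_apply, norm_div, RCLike.norm_ofNat]
  have h1 : w.im ≤ ‖w - (W s.toNNReal : ℂ)‖ := by
    have := abs_im_le_norm (w - (W s.toNNReal : ℂ))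
    rw [sub_im, ofReal_im, sub_zero] at this
    exact (le_abs_self _).trans this
  exact div_le_div_of_nonneg_left (by norm_num) hw h1

/-- **Capacity displacement bound for the Loewner map**: `‖g_t(z) - z‖ ≤ 2t / Im g_t(z)` for
`z ∈ ℍ` and `t < T_z` (integrate `|ġ_s| = 2/|g_s - W_s| ≤ 2/Im g_s ≤ 2/Im g_t`, the imaginary
part being non-increasing along the flow; `2t = hcap(K_t)`).
[cite: Lawler2005, Ch. 4 §4.1 (4.5) with Thm. 4.6] -/
theorem norm_map_sub_self_le_div_im (hW : Continuous W) (hz : 0 < z.im) {t : ℝ≥0}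
    (ht : (t : WithTop ℝ≥0) < swallowingTime W z) :
    ‖map W t z - z‖ ≤ 2 * t / (map W t z).im := by
  have hpos : 0 < (map W t z).im := im_map_pos_of_lt hW hz ht
  have heq : map W t z - z = ∫ s in (0 : ℝ)..t, vectorField W s (map W s.toNNReal z) := by
    rw [map_eq_add_integral hW ht]; ring
  rw [heq]
  have hb : ∀ s ∈ Set.uIoc (0 : ℝ) t, ‖vectorField W s (map W s.toNNReal z)‖ ≤
      2 / (map W t z).im := by
    intro s hs
    rw [uIoc_of_le t.coe_nonneg] at hs
    have hst : s.toNNReal ≤ t := Real.toNNReal_le_iff_le_coe.2 hs.2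
    have hsT : ((s.toNNReal : ℝ≥0) : WithTop ℝ≥0) < swallowingTime W z :=
      lt_of_le_of_lt (WithTop.coe_le_coe.2 hst) ht
    have hims : 0 < (map W s.toNNReal z).im := im_map_pos_of_lt hW hz hsT
    refine (norm_vectorField_le_two_div_im W s hims).trans ?_
    exact div_le_div_of_nonneg_left (by norm_num) hpos (im_map_le_im_map hW hz hst ht)
  calc ‖∫ s in (0 : ℝ)..t, vectorField W s (map W s.toNNReal z)‖
      ≤ 2 / (map W t z).im * |(t : ℝ) - 0| := intervalIntegral.norm_integral_le_of_norm_le_const hb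
    _ = 2 * t / (map W t z).im := by rw [sub_zero, abs_of_nonneg t.coe_nonneg]; ring

namespace ShortTime

variable {t : ℝ≥0}

/-- In the short-time regime `Im g_t(z) ≥ (2/3) Im z`. [folklore] -/
theorem im_map_lower (h : ShortTime W z t) : 2 * z.im / 3 ≤ (map W t z).im := by
  obtain ⟨g, hg⟩ := h.exists_sol
  rw [map_eq_of_isSolution h.cont hg h.lt]
  simpa using h.im_lower hg (s := t) ⟨t.coe_nonneg, le_rfl⟩

/-- **`‖g_t(z) - z‖ ≤ 3t / Im z` in the short-time regime** (`2t/Im g_t ≤ 2t/((2/3) Im z)`).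
[cite: Lawler2005, Ch. 4 §4.1] -/
theorem norm_map_sub_self_le (h : ShortTime W z t) : ‖map W t z - z‖ ≤ 3 * t / z.im := by
  have h1 := norm_map_sub_self_le_div_im h.cont h.im_pos h.lt
  have h2 := h.im_map_lower
  have hy := h.im_pos
  calc ‖map W t z - z‖ ≤ 2 * t / (map W t z).im := h1
    _ ≤ 2 * t / (2 * z.im / 3) := by
        apply div_le_div_of_nonneg_left (by positivity) (by positivity) h2
    _ = 3 * t / z.im := by field_simp

/-- **The exponent is `O(t/(Im z)²)`: `‖∫₀ᵗ -2/(g_s - W_s)² ds‖ ≤ 9t/(2 (Im z)²)`** in the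
short-time regime. [folklore] -/
theorem norm_exponent_le_div (h : ShortTime W z t) {g : ℝ → ℂ}
    (hg : IsSolution W z g (swallowingTime W z)) :
    ‖∫ s in (0 : ℝ)..t, (-2 : ℂ) / ((g s - W s.toNNReal) * (g s - W s.toNNReal))‖ ≤
      9 * t / (2 * z.im ^ 2) := by
  calc ‖∫ s in (0 : ℝ)..t, (-2 : ℂ) / ((g s - W s.toNNReal) * (g s - W s.toNNReal))‖
      ≤ 9 / (2 * z.im ^ 2) * |(t : ℝ) - 0| := by
        refine intervalIntegral.norm_integral_le_of_norm_le_const fun s hs ↦ ?_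
        rw [uIoc_of_le t.coe_nonneg] at hs
        exact h.norm_coeff_le hg ⟨hs.1.le, hs.2⟩
    _ = 9 * t / (2 * z.im ^ 2) := by rw [sub_zero, abs_of_nonneg t.coe_nonneg]; ring

/-- **`|log ‖g_t'(z)‖| ≤ 9t/(2 (Im z)²)`** in the short-time regime (`g_t' = exp J`,
`log ‖g_t'‖ = Re J`). [cite: Lawler2005, Ch. 4 §4.1] -/
theorem abs_log_norm_deriv_map_le (h : ShortTime W z t) :
    |Real.log ‖deriv (map W t) z‖| ≤ 9 * t / (2 * z.im ^ 2) := by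
  obtain ⟨g, hg⟩ := h.exists_sol
  rw [h.deriv_map_eq hg, norm_exp, Real.log_exp]
  exact (abs_re_le_norm _).trans (h.norm_exponent_le_div hg)

/-- The derivative of the Loewner map does not vanish (it is an exponential). [folklore] -/
theorem norm_deriv_map_pos (h : ShortTime W z t) : 0 < ‖deriv (map W t) z‖ := by
  obtain ⟨g, hg⟩ := h.exists_sol
  rw [h.deriv_map_eq hg, norm_exp]
  exact Real.exp_pos _

end ShortTime

/-! ### Late agreement: two drivers that coincide after a short initial time -/

section LateAgree

/-! Throughout: `W`, `W'` are continuous and agree from time `s ≤ t` on; the point `z ∈ ℍ` is far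
in the sense of the cap `16 t ≤ (Im z)²`, and the disagreement interval is short,
`1200 s ≤ (Im z)²` (e.g. `W' = W (· ∨ s)`, the driver frozen before `s`). -/

variable {W' : ℝ≥0 → ℝ} {s t : ℝ≥0} (hW : Continuous W) (hW' : Continuous W')
  (hWW' : ∀ u, s ≤ u → W u = W' u) (hz : 0 < z.im) (hst : s ≤ t)
  (h16 : 16 * (t : ℝ) ≤ z.im ^ 2) (hs : 1200 * (s : ℝ) ≤ z.im ^ 2)

include hW hz h16 in
/-- Short time at `t` (`16 t ≤ (Im z)²` implies `9 t ≤ (Im z)²`). [folklore] -/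
theorem shortTime_of_sixteen_mul_le : ShortTime W z t :=
  ⟨hW, hz, by linarith [h16, t.coe_nonneg]⟩

include hW hz hst h16 in
/-- **The cocycle through the outer map**: `g_t = g^{W(s+·)}_{t-s} ∘ g_s` at `z`.
[cite: Lawler2005, Rem. 4.9] -/
theorem map_eq_map_shift_map :
    map W t z = map (fun v ↦ W (s + v)) (t - s) (map W s z) := by
  have hsu : s + (t - s) = t := add_tsub_cancel_of_le hst
  have hlt : ((s + (t - s) : ℝ≥0) : WithTop ℝ≥0) < swallowingTime W z := by
    rw [hsu]; exact (shortTime_of_sixteen_mul_le hW hz h16).lt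
  rw [← (map_add hW hlt).2, hsu]

include hW hz hst h16 in
/-- **Chain rule through the outer map**: `g_t'(z) = (g^{W(s+·)}_{t-s})'(g_s z) · g_s'(z)`.
[folklore] -/
theorem deriv_map_eq_deriv_shift_mul :
    deriv (map W t) z =
      deriv (map (fun v ↦ W (s + v)) (t - s)) (map W s z) * deriv (map W s) z := by
  have hT := shortTime_of_sixteen_mul_le hW hz h16
  have hsu : s + (t - s) = t := add_tsub_cancel_of_le hst
  have hzT : ((s + (t - s) : ℝ≥0) : WithTop ℝ≥0) < swallowingTime W z := by
    rw [hsu]; exact hT.lt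
  have hev : map W t =ᶠ[𝓝 z] (map (fun v ↦ W (s + v)) (t - s) ∘ map W s) := by
    filter_upwards [(isOpen_setOf_lt_swallowingTime hW (s + (t - s))).mem_nhds hzT]
      with z' hz'
    rw [Function.comp_apply, ← (map_add hW hz').2, hsu]
  rw [hev.deriv_eq]
  have h1 : DifferentiableAt ℂ (map W s) z :=
    (differentiableOn_map_of_lt_swallowingTime hW s).differentiableAt
      ((isOpen_setOf_lt_swallowingTime hW s).mem_nhds (hT.mono hst).lt)
  have hu : ((t - s : ℝ≥0) : WithTop ℝ≥0) < swallowingTime (fun v ↦ W (s + v)) (map W s z) :=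
    (map_add hW hzT).1
  have h2 : DifferentiableAt ℂ (map (fun v ↦ W (s + v)) (t - s)) (map W s z) :=
    (differentiableOn_map_of_lt_swallowingTime (continuous_shift W hW s) (t - s)).differentiableAt
      ((isOpen_setOf_lt_swallowingTime (continuous_shift W hW s) (t - s)).mem_nhds hu)
  exact deriv_comp z h2 h1

include hW hW' hz hst h16 in
/-- **The two inner points are close**, in units of the radius `Im z/6`:
`‖g_s z - g'_s z‖ ≤ 6 s/Im z = (36 s/(Im z)²) · (Im z/6)`. [folklore] -/
theorem norm_map_sub_map_le_inner :
    ‖map W s z - map W' s z‖ ≤ 36 * s / z.im ^ 2 * (z.im / 6) := by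
  have h1 := ((shortTime_of_sixteen_mul_le hW hz h16).mono hst).norm_map_sub_self_le
  have h2 := ((shortTime_of_sixteen_mul_le hW' hz h16).mono hst).norm_map_sub_self_le
  calc ‖map W s z - map W' s z‖ = ‖(map W s z - z) - (map W' s z - z)‖ := by ring_nf
    _ ≤ ‖map W s z - z‖ + ‖map W' s z - z‖ := norm_sub_le _ _
    _ ≤ 3 * s / z.im + 3 * s / z.im := add_le_add h1 h2
    _ = 36 * s / z.im ^ 2 * (z.im / 6) := by field_simp; ring

include hz hs in
/-- The relative closeness parameter is small: `36 s/(Im z)² ≤ 1/32`. [folklore] -/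
theorem rho_le_of_small : 36 * (s : ℝ) / z.im ^ 2 ≤ 1 / 32 := by
  rw [div_le_div_iff₀ (by positivity) (by norm_num)]
  nlinarith [hs, NNReal.coe_nonneg s]

include hW hW' hz hst h16 in
/-- **The disc `B(g'_s z, Im z/6)` lies in the domain of the shifted driver at time `t - s`**
(its points have `Im > Im z/2 ≥ 2√(t-s)`, so they are not swallowed). [folklore] -/
theorem ball_subset_domain_shift :
    ball (map W' s z) (z.im / 6) ⊆ domain (fun v ↦ W (s + v)) (t - s) := by
  intro ζ hζ
  have hc : 2 * z.im / 3 ≤ (map W' s z).im :=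
    ((shortTime_of_sixteen_mul_le hW' hz h16).mono hst).im_map_lower
  rw [Metric.mem_ball, dist_eq_norm] at hζ
  have hζim : z.im / 2 < ζ.im := by
    have h6 := abs_im_le_norm (ζ - map W' s z)
    have h7 := neg_abs_le (ζ - map W' s z).im
    rw [sub_im] at h6 h7
    linarith
  have hζpos : 0 < ζ.im := by linarith
  refine (mem_domain_iff _ _ _).2 ⟨hζpos,
    lt_swallowingTime_of_four_mul_lt (continuous_shift W hW s) hζpos ?_⟩
  have hts : ((t - s : ℝ≥0) : ℝ) ≤ t := by exact_mod_cast tsub_le_self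
  nlinarith [h16]

include hW hW' hz hst h16 in
/-- The outer map is holomorphic and injective on the disc and sends it into `ℍ`. [folklore] -/
theorem univalent_shift_ball :
    DifferentiableOn ℂ (map (fun v ↦ W (s + v)) (t - s)) (ball (map W' s z) (z.im / 6)) ∧
    InjOn (map (fun v ↦ W (s + v)) (t - s)) (ball (map W' s z) (z.im / 6)) ∧
    MapsTo (map (fun v ↦ W (s + v)) (t - s)) (ball (map W' s z) (z.im / 6)) upperHalfPlaneSet := by
  have hB := ball_subset_domain_shift hW hW' hz hst h16
  have hc := continuous_shift W hW s
  exact ⟨(differentiableOn_map_of_lt_swallowingTime hc (t - s)).mono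
      fun _ hζ ↦ ((mem_domain_iff _ _ _).1 (hB hζ)).2,
    (injOn_map_of_lt_swallowingTime hc (t - s)).mono fun _ hζ ↦ ((mem_domain_iff _ _ _).1 (hB hζ)).2,
    fun _ hζ ↦ mapsTo_map hc (t - s) (hB hζ)⟩

include hW hz hst h16 in
/-- `Im z · |g_t'(z)| / Im g_t(z)` factorises through the outer map. [folklore] -/
theorem derivRatio_eq_shift :
    derivRatio W z t = z.im * (‖deriv (map (fun v ↦ W (s + v)) (t - s)) (map W s z)‖ *
      ‖deriv (map W s) z‖) / (map (fun v ↦ W (s + v)) (t - s) (map W s z)).im := by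
  rw [derivRatio_apply, deriv_map_eq_deriv_shift_mul hW hz hst h16, norm_mul,
    map_eq_map_shift_map hW hz hst h16]

include hW hW' hWW' hz hst h16 hs

/-- **Late agreement, conformal-radius part**: `|log ψ_t(z) - log ψ'_t(z)| ≤ 1500 s/(Im z)²`
for Rohde–Schramm's ratios `ψ = derivRatio` of the two chains.
[cite: Lawler2005, Ch. 4 §4.1 with Rem. 4.9] -/
theorem abs_log_derivRatio_sub_le_of_eqOn :
    |Real.log (derivRatio W z t) - Real.log (derivRatio W' z t)| ≤ 1500 * s / z.im ^ 2 := by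
  have hR : 0 < z.im / 6 := by positivity
  have hshift : (fun v ↦ W (s + v)) = fun v ↦ W' (s + v) :=
    funext fun _ ↦ hWW' _ le_self_add
  obtain ⟨hd, hi, hm⟩ := univalent_shift_ball hW hW' hz hst h16
  have hnear := norm_map_sub_map_le_inner hW hW' hz hst h16
  have hρ := rho_le_of_small hz hs
  set hmap := map (fun v ↦ W (s + v)) (t - s) with hh
  have hA := abs_log_norm_deriv_sub_le hR hd hi hnear (hρ.trans (by norm_num))
  have hB := abs_log_im_sub_log_im_le hR hd hi hm hnear hρ
  have hTs := (shortTime_of_sixteen_mul_le hW hz h16).mono hst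
  have hTs' := (shortTime_of_sixteen_mul_le hW' hz h16).mono hst
  have hC := hTs.abs_log_norm_deriv_map_le
  have hC' := hTs'.abs_log_norm_deriv_map_le
  have hmem : map W s z ∈ ball (map W' s z) (z.im / 6) := mem_ball_of_norm_sub_le hR hnear hρ
  have hpos1 : 0 < (hmap (map W s z)).im := hm hmem
  have hpos2 : 0 < (hmap (map W' s z)).im := hm (mem_ball_self hR)
  have hd1 : 0 < ‖deriv (map W s) z‖ := hTs.norm_deriv_map_pos
  have hd2 : 0 < ‖deriv (map W' s) z‖ := hTs'.norm_deriv_map_pos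
  -- the outer derivative does not vanish on the disc (univalence)
  have hod : ∀ ζ ∈ ball (map W' s z) (z.im / 6), 0 < ‖deriv hmap ζ‖ := by
    intro ζ hζ
    have hsub : ball ζ (z.im / 6 - dist ζ (map W' s z)) ⊆ ball (map W' s z) (z.im / 6) :=
      ball_subset_ball' (by linarith)
    have hr : 0 < z.im / 6 - dist ζ (map W' s z) := by rw [Metric.mem_ball] at hζ; linarith
    exact norm_deriv_pos_of_injOn hr (hd.mono hsub) (hi.mono hsub)
  have ho1 : 0 < ‖deriv hmap (map W s z)‖ := hod _ hmem
  have ho2 : 0 < ‖deriv hmap (map W' s z)‖ := hod _ (mem_ball_self hR)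
  have e1 : Real.log (derivRatio W z t) = Real.log z.im + Real.log ‖deriv hmap (map W s z)‖ +
      Real.log ‖deriv (map W s) z‖ - Real.log (hmap (map W s z)).im := by
    rw [derivRatio_eq_shift hW hz hst h16, Real.log_div (by positivity) hpos1.ne',
      Real.log_mul (by positivity) (by positivity), Real.log_mul ho1.ne' hd1.ne']
    ring
  have e2 : Real.log (derivRatio W' z t) = Real.log z.im + Real.log ‖deriv hmap (map W' s z)‖ +
      Real.log ‖deriv (map W' s) z‖ - Real.log (hmap (map W' s z)).im := by
    rw [derivRatio_eq_shift hW' hz hst h16, ← hshift, Real.log_div (by positivity) hpos2.ne',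
      Real.log_mul (by positivity) (by positivity), Real.log_mul ho2.ne' hd2.ne']
    ring
  rw [e1, e2]
  set A := Real.log ‖deriv hmap (map W s z)‖ - Real.log ‖deriv hmap (map W' s z)‖ with hAdef
  set B := Real.log ‖deriv (map W s) z‖ with hBdef
  set C := Real.log ‖deriv (map W' s) z‖ with hCdef
  set D := Real.log (hmap (map W s z)).im - Real.log (hmap (map W' s z)).im with hDdef
  have key : |A| + |B| + |C| + |D| ≤ 1500 * s / z.im ^ 2 := by
    have : 7 * (36 * (s : ℝ) / z.im ^ 2) + 9 * s / (2 * z.im ^ 2) + 9 * s / (2 * z.im ^ 2) +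
        32 * (36 * (s : ℝ) / z.im ^ 2) ≤ 1500 * s / z.im ^ 2 := by
      rw [show 7 * (36 * (s : ℝ) / z.im ^ 2) + 9 * s / (2 * z.im ^ 2) + 9 * s / (2 * z.im ^ 2) +
        32 * (36 * (s : ℝ) / z.im ^ 2) = 1413 * s / z.im ^ 2 by field_simp; ring]
      gcongr; norm_num
    linarith [hA, hB, hC, hC']
  have hx : Real.log z.im + Real.log ‖deriv hmap (map W s z)‖ + Real.log ‖deriv (map W s) z‖ -
      Real.log (hmap (map W s z)).im - (Real.log z.im + Real.log ‖deriv hmap (map W' s z)‖ +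
      Real.log ‖deriv (map W' s) z‖ - Real.log (hmap (map W' s z)).im) = A + B - C - D := by
    rw [hAdef, hBdef, hCdef, hDdef]; ring
  rw [hx]
  calc |A + B - C - D| ≤ |A + B - C| + |D| := abs_sub _ _
    _ ≤ |A + B| + |C| + |D| := by gcongr; exact abs_sub _ _
    _ ≤ |A| + |B| + |C| + |D| := by gcongr; exact abs_add_le _ _
    _ ≤ 1500 * s / z.im ^ 2 := key

/-- **Late agreement, Schramm part**: `|S_t(z) - S'_t(z)| ≤ 600 s/(Im z)²` for Schramm's
observables of the two chains (the directions of `g_t(z) - W_t` and `g'_t(z) - W_t` seen from the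
common real base point `W_t = W'_t`). [cite: Lawler2005, Ch. 4 §4.1 with Rem. 4.9] -/
theorem abs_schrammObs_sub_le_of_eqOn :
    |schrammObs W z t - schrammObs W' z t| ≤ 600 * s / z.im ^ 2 := by
  have hR : 0 < z.im / 6 := by positivity
  have hshift : (fun v ↦ W (s + v)) = fun v ↦ W' (s + v) :=
    funext fun _ ↦ hWW' _ le_self_add
  obtain ⟨hd, hi, hm⟩ := univalent_shift_ball hW hW' hz hst h16
  have h1 := abs_re_unit_sub_re_unit_le hR hd hi hm (norm_map_sub_map_le_inner hW hW' hz hst h16)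
    (rho_le_of_small hz hs) (W t)
  have e1 : centredMap W t z = map (fun v ↦ W (s + v)) (t - s) (map W s z) - W t := by
    rw [centredMap_apply, map_eq_map_shift_map hW hz hst h16]
  have e2 : centredMap W' t z = map (fun v ↦ W (s + v)) (t - s) (map W' s z) - W t := by
    rw [centredMap_apply, map_eq_map_shift_map hW' hz hst h16, ← hshift, hWW' t hst]
  simp only [schrammObs, e1, e2]
  rw [show ∀ a b : ℝ, (1 + a) / 2 - (1 + b) / 2 = (a - b) / 2 from fun a b ↦ by ring, abs_div,
    abs_two]
  calc |_| / 2 ≤ 32 * (36 * s / z.im ^ 2) / 2 := by gcongr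
    _ = 576 * s / z.im ^ 2 := by ring
    _ ≤ 600 * s / z.im ^ 2 := by gcongr; norm_num

/-- **Late agreement, the maps**: `‖g_t(z) - g'_t(z)‖ ≤ 600 s / Im z`. [folklore] -/
theorem norm_map_sub_map_le_of_eqOn : ‖map W t z - map W' t z‖ ≤ 600 * s / z.im := by
  have hR : 0 < z.im / 6 := by positivity
  have hshift : (fun v ↦ W (s + v)) = fun v ↦ W' (s + v) :=
    funext fun _ ↦ hWW' _ le_self_add
  obtain ⟨hd, hi, hm⟩ := univalent_shift_ball hW hW' hz hst h16
  have h1 := norm_sub_le_mul_im hR hd hi hm (norm_map_sub_map_le_inner hW hW' hz hst h16)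
    (rho_le_of_small hz hs)
  have e2 : map W' t z = map (fun v ↦ W (s + v)) (t - s) (map W' s z) := by
    rw [map_eq_map_shift_map hW' hz hst h16, ← hshift]
  have him : (map (fun v ↦ W (s + v)) (t - s) (map W' s z)).im ≤ z.im := by
    rw [← e2]
    exact im_map_le hW' hz (shortTime_of_sixteen_mul_le hW' hz h16).lt
  rw [map_eq_map_shift_map hW hz hst h16, e2]
  calc _ ≤ 16 * (36 * s / z.im ^ 2) * (map (fun v ↦ W (s + v)) (t - s) (map W' s z)).im := h1
    _ ≤ 16 * (36 * s / z.im ^ 2) * z.im := by gcongr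
    _ = 576 * s / z.im := by field_simp; ring
    _ ≤ 600 * s / z.im := by gcongr; norm_num

end LateAgree

/-! ### The driver frozen before a threshold -/

/-- **The driver frozen before `s`, `u ↦ W (u ∨ s)`, has the same chain at far points up to
`O(s/(Im z)²)`**: the three late-agreement bounds for `W' = W (· ∨ s)`. [folklore] -/
theorem late_agreement_max (hW : Continuous W) (hz : 0 < z.im) {s t : ℝ≥0} (hst : s ≤ t)
    (h16 : 16 * (t : ℝ) ≤ z.im ^ 2) (hs : 1200 * (s : ℝ) ≤ z.im ^ 2) :
    |Real.log (derivRatio W z t) - Real.log (derivRatio (fun u ↦ W (max u s)) z t)| ≤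
        1500 * s / z.im ^ 2 ∧
      |schrammObs W z t - schrammObs (fun u ↦ W (max u s)) z t| ≤ 600 * s / z.im ^ 2 ∧
      ‖map W t z - map (fun u ↦ W (max u s)) t z‖ ≤ 600 * s / z.im := by
  have hc : Continuous fun u ↦ W (max u s) := hW.comp (continuous_id.max continuous_const)
  have ha : ∀ u, s ≤ u → W u = W (max u s) := fun u hu ↦ by rw [max_eq_left hu]
  exact ⟨abs_log_derivRatio_sub_le_of_eqOn hW hc ha hz hst h16 hs,
    abs_schrammObs_sub_le_of_eqOn hW hc ha hz hst h16 hs,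
    norm_map_sub_map_le_of_eqOn hW hc ha hz hst h16 hs⟩

end Loewner

end Literature.Probability.RandomPlanarGeometry

end
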